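import Summits.HodgeConjecture.HodgeConjecture.Theorems.EndoscopicMiddleDegreeOrthogonalEnvelopedHeckeGraphAnalytic
import Literature.AlgebraicGeometry.HodgeTheory.HodgeModelExistenceProofs

/-!
# Stub `stub_levelCoverCompactT2` (line `purity-sorted-hecke-envelope` of crux
# `EndoscopicMiddleDegree.OrthogonalEnveloped`, stmt-HodgeConjecture-14300): level covers of finite index
# are compact Hausdorff

Registered skeleton `Cruxes/OrthogonalEnveloped/Lines/purity_sorted_hecke_envelope.lean` (rev c6-L1, stub L1);
this is the file `Theorems/EndoscopicMiddleDegreeOrthogonalEnvelopedLevelCoverCompactT2.lean` of the summit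
(`--supports stmt-HodgeConjecture-14300`).

WHAT IS PROVED (`stub_levelCoverCompactT2`, signature byte-identical with the registered stub). For a compact
ball quotient datum `D : UnitaryBallQuotientDatum p X` (`X(ℂ) ≅ Γ \ 𝔹`) and a normal subgroup `N ⊴ Γ` of
finite index, the level cover `D.LevelCover N = N \ 𝔹` is COMPACT and HAUSDORFF. (The covering-map
hypothesis of the registered signature is not needed and not used.)

HOW (pure point-set topology; Shimura 1971 §7.2 for the compact quotients `S(N)`, Hatcher §1.3 Prop. 1.40
for orbit spaces of covering-space actions).
* Hausdorff: the ball `𝔹` is locally compact Hausdorff (`HeckeGraphChow.stub_ballLocallyCompactT2`) and `Γ`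
  acts on it properly discontinuously (`HeckeGraphChow.stub_properlyDiscontinuous`) by homeomorphisms; so
  does the subgroup `N` (Mathlib: subgroups of properly discontinuous groups are properly discontinuous),
  hence the orbit space `N \ 𝔹` is Hausdorff (Mathlib `t2Space_of_properlyDiscontinuousSMul_of_t2Space`).
* Compact: `X(ℂ)` is compact (`compactSpace_complexPoints_of_isSmoothProjective`) and `𝔹 → X(ℂ)` is an
  open surjection from a locally compact space (`isOpenMap_ballUnif`, `surjective_ballUnif`), so finitely
  many compact neighbourhoods of the ball already surject: there is a compact `K ⊆ 𝔹` with `Γ K = 𝔹`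
  (`ballUnif_eq_iff`: the fibres of `𝔹 → X(ℂ)` are the `Γ`-orbits). Then
  `N \ 𝔹 = ⋃_{q ∈ Γ/N} q • (N \ K)` is a finite union (`[Γ : N] < ∞`) of continuous images of the compact
  `K`, hence compact.
-/

noncomputable section

-- The crux-workfile namespace `Summit.<P>.<Sub>.Cruxes.…` repeats `HodgeConjecture` (single-conjunct summit).
set_option linter.dupNamespace false

namespace Summit.HodgeConjecture.HodgeConjecture.Cruxes.OrthogonalEnveloped.PuritySortedHeckeEnvelope

open Literature.AlgebraicGeometry.Motives (SchemeOver ComplexPoints IsSmoothProjective)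
open Literature.AlgebraicGeometry.HodgeTheory
open Literature.AlgebraicGeometry.ShimuraVarieties
open Summit.HodgeConjecture.HodgeConjecture.Cruxes.OrthogonalEnveloped.HeckeGraphChow
  (stub_properlyDiscontinuous isCancelSMul_ball stub_ballLocallyCompactT2)

variable {p : ℕ} {X : SchemeOver ℂ}

/-! ## A compact fundamental set for `Γ` on the ball -/

/-- **A compact set of the ball surjecting onto `X(ℂ)`.** If the ball is locally compact and `X(ℂ)` is
compact, some compact `K ⊆ 𝔹` has `unif K = X(ℂ)`: the images of the interiors of compact neighbourhoods
of the points of `𝔹` under the OPEN map `𝔹 → X(ℂ)` cover `X(ℂ)` (`𝔹 → X(ℂ)` is onto); take a finite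
subcover. [cite: Shimura1973, Ch. 7 §7.2] -/
theorem levelCoverCompactT2_exists_isCompact_image_eq_univ (D : UnitaryBallQuotientDatum p X)
    [LocallyCompactSpace D.ball] [CompactSpace (ComplexPoints X)] :
    ∃ K : Set D.ball, IsCompact K ∧ D.ballUnif '' K = Set.univ := by
  have hcover : (Set.univ : Set (ComplexPoints X)) ⊆
      ⋃ b : D.ball, D.ballUnif '' interior (Classical.choose (exists_compact_mem_nhds b)) := by
    intro P _
    obtain ⟨b, rfl⟩ := D.surjective_ballUnif P
    exact Set.mem_iUnion.2 ⟨b, Set.mem_image_of_mem _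
      (mem_interior_iff_mem_nhds.2 (Classical.choose_spec (exists_compact_mem_nhds b)).2)⟩
  obtain ⟨t, ht⟩ := isCompact_univ.elim_finite_subcover _
    (fun b ↦ D.isOpenMap_ballUnif _ isOpen_interior) hcover
  refine ⟨⋃ b ∈ t, Classical.choose (exists_compact_mem_nhds b),
    t.isCompact_biUnion fun b _ ↦ (Classical.choose_spec (exists_compact_mem_nhds b)).1,
    Set.eq_univ_of_forall fun P ↦ ?_⟩
  obtain ⟨b, hb, hP⟩ := Set.mem_iUnion₂.1 (ht (Set.mem_univ P))
  obtain ⟨c, hc, rfl⟩ := hP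
  exact ⟨c, Set.mem_iUnion₂.2 ⟨b, hb, interior_subset hc⟩, rfl⟩

/-! ## Compactness and the Hausdorff property of `N \ 𝔹` -/

/-- **Level covers of finite index are compact.** With `K ⊆ 𝔹` compact and `unif K = X(ℂ)`
(`levelCoverCompactT2_exists_isCompact_image_eq_univ`), every point `N b` of `N \ 𝔹` has `b = γ k` for some
`k ∈ K`, `γ ∈ Γ` (the fibres of `𝔹 → X(ℂ)` are the `Γ`-orbits, `ballUnif_eq_iff`), i.e.
`N b = (γ N) • N k`; so `N \ 𝔹 = ⋃_{q ∈ Γ / N} q • (N \ K)`, a finite union of compact sets.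
[cite: Shimura1973, Ch. 7 §7.2] -/
theorem levelCoverCompactT2_compactSpace (D : UnitaryBallQuotientDatum p X) (N : Subgroup ↥D.Γ)
    [N.Normal] [N.FiniteIndex] [LocallyCompactSpace D.ball] [CompactSpace (ComplexPoints X)] :
    CompactSpace (D.LevelCover N) := by
  obtain ⟨K, hK, hKU⟩ := levelCoverCompactT2_exists_isCompact_image_eq_univ D
  have hcpt : IsCompact (⋃ q : ↥D.Γ ⧸ N,
      (fun e : D.LevelCover N ↦ q • e) '' (D.toLevel N '' K)) :=
    isCompact_iUnion fun q ↦ (hK.image continuous_quotient_mk').image (continuous_const_smul q)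
  refine ⟨hcpt.of_isClosed_subset isClosed_univ fun e _ ↦ ?_⟩
  induction e using Quotient.inductionOn with
  | h b =>
    -- `b = γ • k` with `k ∈ K`
    obtain ⟨k, hk, hkb⟩ : D.ballUnif b ∈ D.ballUnif '' K := hKU ▸ Set.mem_univ _
    obtain ⟨γ, rfl⟩ := MulAction.mem_orbit_iff.1 ((D.ballUnif_eq_iff b k).1 hkb.symm)
    exact Set.mem_iUnion.2 ⟨QuotientGroup.mk γ, D.toLevel N k, ⟨k, hk, rfl⟩,
      Literature.Topology.CoveringSpaces.OrbitQuotient.mk_smul_mk N γ k⟩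

/-- **Level covers are Hausdorff.** `N ≤ Γ` acts properly discontinuously (as `Γ` does) by
homeomorphisms on the locally compact Hausdorff ball, so its orbit space is Hausdorff.
[cite: HatcherAT2002, §1.3 Prop. 1.40] -/
theorem levelCoverCompactT2_t2Space (D : UnitaryBallQuotientDatum p X) (N : Subgroup ↥D.Γ)
    [LocallyCompactSpace D.ball] [T2Space D.ball] [ProperlyDiscontinuousSMul ↥D.Γ D.ball] :
    T2Space (D.LevelCover N) :=
  t2Space_of_properlyDiscontinuousSMul_of_t2Space

/-- **Stub L1 — level covers of finite index are compact Hausdorff.** For `N ⊴ Γ` of finite index with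
`N \ 𝔹 → X(ℂ)` a covering map, the level cover `N \ 𝔹` is compact (a finite-sheeted cover of the compact
`X(ℂ)`, `compactSpace_complexPoints_of_isSmoothProjective`; equivalently the image of finitely many translates
of a compact set of the locally compact ball surjecting onto `X(ℂ)`) and Hausdorff (orbit space of the properly
discontinuous action of `N ≤ Γ` on the locally compact Hausdorff ball — `stub_properlyDiscontinuous`,
`stub_ballLocallyCompactT2` — or: a covering space of a Hausdorff space).
[cite: Shimura1973, Ch. 7 §7.2] [cite: HatcherAT2002, §1.3 Prop. 1.40] -/
theorem stub_levelCoverCompactT2 :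
    ∀ {p : ℕ} {X : SchemeOver ℂ} (D : UnitaryBallQuotientDatum p X) (N : Subgroup ↥D.Γ) [N.Normal]
      [N.FiniteIndex], IsCoveringMap (D.levelProj N) →
      CompactSpace (D.LevelCover N) ∧ T2Space (D.LevelCover N) := by
  intro p X D N _ _ _
  obtain ⟨hlc, ht2⟩ := stub_ballLocallyCompactT2 D
  haveI := hlc
  haveI := ht2
  haveI := stub_properlyDiscontinuous D
  haveI := compactSpace_complexPoints_of_isSmoothProjective D.isSmoothProjective
  exact ⟨levelCoverCompactT2_compactSpace D N, levelCoverCompactT2_t2Space D N⟩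

end Summit.HodgeConjecture.HodgeConjecture.Cruxes.OrthogonalEnveloped.PuritySortedHeckeEnvelope

end
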